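import Literature.NumberTheory.EllipticCurves.Rank1Residual.Typed.X6
import Literature.NumberTheory.EllipticCurves.Rank1Residual.X9TrivialPartner
import HarnessLib

/-!
# Good supersingular primes, analytic rank `0`: the typed LOWER bound `ord_p #Ш ≥ ord_p #Ш_an`
# from ONE divisibility of Kobayashi's signed main conjecture — the ± rank-zero chain as a SHAPE
# (cell `b2b-bsdres`, supersingular family, prover A = unit `b2b-bsdres-x10b`, gen 3)

HONEST FRAMING (run/shared/lean/b2b/bsd-rank1-residual/, verbatim in every file): the goal of the
cell is to DELETE the COMBINATION-SHAPED residual classes of the Birch–Swinnerton-Dyer formula for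
ALL analytic-rank `≤ 1` elliptic curves over `ℚ` — "full BSD formula for every rank `≤ 1` curve in
class `C`" assembled STRICTLY from published theorems — so that the rank-`≤ 1` remainder becomes
exactly the CONSTRUCTION-SHAPED classes, which are TYPED (missing-input `Prop`s), NOT attempted.
This is not "finishing BSD". Theorems and ONE hypothesis structure; NO named fact; no label change
(X6 / X7 stay CONSTRUCTION-SHAPED); nothing about any curve is asserted.

## What this file is

Classes X6 (`ss(p) ∧ sst ∧ (p ≥ 5 ∨ a_3 = 0)`) and X7 (`ss(p) ∧ ¬sst`) in analytic rank `0` at an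
odd prime have their UPPER half in print (Wuthrich 2014 Prop. 21 under `surj`, automatic on X6 by
Serre; `Typed.X6.missingInputAt_iff_missingLowerBoundAt_of_analyticRank_eq_zero`): the typed missing
input IS `MissingLowerBoundAt W p` (`ord_p #Ш_an ≤ ord_p #Ш`), announced by Burungale–Skinner–
Tian–Wan (arXiv:2409.01350, Thm. 1.3 = Kobayashi's ± main conjecture for semistable `E`; PRE, typed
OPEN as `BurungaleSkinnerTianWan2024.thm15_pPart_OPEN`). This file records, in the kernel, the
published CHAIN that turns ONE divisibility of Kobayashi's signed main conjecture into that lower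
bound — so that the typed residue of X6 ∩ {r_an = 0} can be read as "the Eisenstein divisibility
`L_p^ε ∣ ξ_p^ε` at `(E, p)` for one sign `ε`", the exact analogue of the cell's ordinary-prime
reading `X10b ⇐ MazurMainConjecture W 3` (p195323) — with the three published inputs displayed as
explicit binders:

* (K) B. D. Kim, J. Aust. Math. Soc. 95 (2013) Thm. 1.2 / Cor. 3.15 — the signed `Γ`-Euler
  characteristic in rank `0`, as quoted VERBATIM by Ray–Sprung, Ann. Inst. Fourier 75 (2025) §1.2
  [corpus: paper:doi-10-5802-aif-3702 p. 2343]: "When `Sel_p(E/F)` is finite, one can use a control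
  theorem to prove `Sel^±_p(E/F_cyc)` are cotorsion. Kim then showed that
  `f^±(0) ∼ #Sel_p(E/F) · ∏_ℓ c_ℓ`." (`F = ℚ`; `∼` = up to a `p`-adic unit) — binder
  `SignedDatum.EulerCharacteristic`;
* (P) Pollack, Duke Math. J. 118 (2003) (construction of `L_p^± ∈ Λ` for `a_p = 0`) with the
  interpolation at the trivial character, `L_p^+(0) = (p − 1)·L(E,1)/Ω_E`, `L_p^−(0) = 2·L(E,1)/Ω_E`
  up to the cell's period-ratio unit (Kobayashi, Invent. Math. 152 (2003) §3; Sprung, J. Number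
  Theory 132 (2012) §1 [corpus: paper:doi-10-1016-j-jnt-2011-11-003]) — binder
  `SignedDatum.Interpolation` with the interpolation constant `c` only asked to be prime to `p`;
* (MC↓) the LOWER divisibility `L_p^ε ∣ ξ_p^ε` in `Λ` — OPEN (BSTW Thm. 1.3 proves `(ξ^±) = (L^±)`
  for semistable `E`, `p > 2`; Kobayashi 2003 Thm. 4.1 gives only the Kato-side inclusion
  `Char(X^±) ⊇ (pⁿ L_p^±)`) — binder `SignedDatum.LowerDivisibility`.

VOCABULARY GAP (stated, not hidden): the tree has NO signed objects yet — neither Kobayashi's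
`Sel^±_{p^∞}(E/ℚ_∞)` (the trace-compatible "half" local condition in the formal group along the
cyclotomic tower) nor Pollack's half-logarithms / `L_p^±` (the tree's `padicLFunction f α` takes
`α ∈ ℚ_p`, while at a supersingular prime `α = ±√−p ∉ ℚ_p`). Therefore `SignedDatum W p` below is a
HYPOTHESIS STRUCTURE carrying the pair `(ξ, L) ∈ Λ²` and the interpolation constant as DATA, and
(K), (P), (MC↓) are predicates ON THE DATUM: the theorems say precisely "for any pair of elements of
`Λ` satisfying Kim's identity, Pollack's identity and the divisibility, the lower bound holds" —
the arithmetic (that Kobayashi's `ξ^ε` and Pollack's `L^ε` ARE such a pair) is the content of the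
three citations and is NOT asserted here. Building the signed objects as tree vocabulary is the
next generation's task (X6-ROUTE.md §3, HOME/b2b-bsdres-x10b/); when they exist, `SignedDatum` is
instantiated and (K), (P) become named facts with these exact bodies.

## Contents

* `SignedDatum W p` (hypothesis structure: `xi`, `L : IwasawaAlgebra p`, `c : ℕ`), the predicates
  `EulerCharacteristic`, `Interpolation`, `LowerDivisibility`, `UpperDivisibility`;
* helpers `shaAn_eq_of_analyticRank_eq_zero`, `padicValRat_shaAn_witness`, `valuation_constantCoeff_xi`,
  `valuation_constantCoeff_L` (bookkeeping);
* `missingLowerBoundAt_of_signedLowerDivisibility` — rank `0`, `E[p]` irreducible (so `p ∤ #E(ℚ)_tors`),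
  `p ∤ c`: (K) ∧ (P) ∧ (MC↓) ⇒ `MissingLowerBoundAt W p` (valuations of constant terms:
  `ord_p(L(E,1)/Ω) = ord_p L^ε(0) ≤ ord_p ξ^ε(0) = ord_p(#Sel_{p^∞}·∏c) = ord_p(#Ш·∏c)`; GZK for
  `rank = 0` and `#Ш < ∞`);
* `missingUpperBoundAt_of_signedUpperDivisibility` — the symmetric statement from (MC↑)
  (Kobayashi's Kato-side divisibility, integral under `surj`; in print — recorded for completeness,
  the cell's rank-0 upper bound of record stays Wuthrich Prop. 21);
* `X6.bsdp_of_signedLowerDivisibility_of_analyticRank_eq_zero` — on X6 ∩ {r_an = 0}, odd `p`: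
  Wuthrich (PUB) + (K) + (P) + (MC↓) ⇒ `BSDp W p`; irreducibility automatic (`ClassX6.irr`).

References: Kobayashi, Invent. Math. 152 (2003) Thms. 1.2, 1.3, 4.1 [Kobayashi2003]; Pollack,
Duke Math. J. 118 (2003) [Pollack2003]; B. D. Kim, J. Aust. Math. Soc. 95 (2013) Thm. 1.2
[BDKim2013]; Ray–Sprung, Ann. Inst. Fourier 75 (2025) §1.2 [RaySprung2025]; Castella, Pure Appl.
Math. Q. (2025) Rem. 1.1.1 (Kato MC ⟺ Kobayashi MC) [Castella2025];
Burungale–Skinner–Tian–Wan arXiv:2409.01350 Thm. 1.3 [BurungaleSkinnerTianWan2024, PRE];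
Wuthrich, Doc. Math. 19 (2014) Prop. 21 [Wuthrich2014]; Miller 2011 Def. 1.1 [Miller2011LMS].
-/

set_option autoImplicit false

noncomputable section

open scoped Classical

open WeierstrassCurve Literature.NumberTheory.EllipticCurves
  Literature.NumberTheory.EllipticCurves.Rank1Residual
  Literature.NumberTheory.EllipticCurves.Rank1Residual.Typed

namespace Summit.BirchSwinnertonDyer.Rank1Residual.Supersingular

/-- **Signed Iwasawa datum at `(E, p)` — HYPOTHESIS STRUCTURE, nothing asserted.** The intended
instance (not constructible in the tree's current vocabulary, see the module docstring): for a sign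
`ε ∈ {+, −}` at a good supersingular prime `p` with `a_p = 0`, `xi` = a characteristic power series
`ξ_p^ε ∈ Λ = ℤ_p⟦T⟧` of Kobayashi's `X^ε(E/ℚ_∞) = Sel^ε_{p^∞}(E/ℚ_∞)^∨` (Λ-torsion: Kobayashi 2003
Thm. 1.2), `L` = Pollack's signed `p`-adic `L`-function `L_p^ε ∈ Λ` in the Néron normalisation, and
`c` = its interpolation constant at the trivial character (`p − 1` for `ε = +`, `2` for `ε = −`).
[cite: Kobayashi2003, Thm. 1.2 (shape only; nothing asserted)] -/
structure SignedDatum (W : WeierstrassCurve ℚ) (p : ℕ) [Fact p.Prime] where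
  /-- A characteristic power series `ξ_p^ε` of the signed Selmer group (datum). -/
  xi : IwasawaAlgebra p
  /-- The signed `p`-adic `L`-function `L_p^ε` (datum). -/
  L : IwasawaAlgebra p
  /-- The interpolation constant at the trivial character (datum; `p − 1` or `2` in print). -/
  c : ℕ

namespace SignedDatum

variable {W : WeierstrassCurve ℚ} {p : ℕ} [Fact p.Prime] (D : SignedDatum W p)

/-- **(K) Kim's signed Euler characteristic in rank `0`, as a predicate on the datum**: if
`Sel_{p^∞}(E/ℚ)` is finite then `ξ^ε(0) ∼ #Sel_{p^∞}(E/ℚ) · ∏_ℓ c_ℓ` up to a `p`-adic unit (Ray–Sprung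
2025 §1.2 quoting B. D. Kim 2013 Thm. 1.2 / Cor. 3.15; `E(ℚ)[p] = 0` at a supersingular `p`, so no
torsion factor). Nothing asserted. [cite: RaySprung2025, §1.2 (p. 2343) (shape only; nothing asserted)] -/
def EulerCharacteristic : Prop :=
  Finite (W.selmerGroupPInfty p) →
    ∃ u : ℤ_[p]ˣ, ((PowerSeries.constantCoeff D.xi : ℤ_[p]) : ℚ_[p]) =
      ((u : ℤ_[p]) : ℚ_[p]) * (p : ℚ_[p]) ^ (padicValNat p W.tamagawaProduct) *
        (Nat.card (W.selmerGroupPInfty p) : ℚ_[p])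

/-- **(P) Pollack's interpolation at the trivial character, as a predicate on the datum**:
`L^ε(0) = c · L(E,1)/Ω_E` with `L(E,1)/Ω_E ∈ ℚ` (`c = p − 1`, resp. `2`; the Néron/newform period
ratio is a `p`-adic unit at an irreducible odd prime and is absorbed in `c` only through `p ∤ c`).
Nothing asserted. [cite: Kobayashi2003, §3 (shape only; nothing asserted)] -/
def Interpolation : Prop :=
  ∃ t : ℚ, W.entireLFunction 1 / (W.realPeriodRat : ℂ) = (t : ℂ) ∧
    ((PowerSeries.constantCoeff D.L : ℤ_[p]) : ℚ_[p]) = (D.c : ℚ_[p]) * ((t : ℚ) : ℚ_[p])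

/-- **(MC↓) the Eisenstein-side divisibility of Kobayashi's signed main conjecture**:
`L_p^ε ∣ ξ_p^ε` in `Λ` — the OPEN input on X6/X7 in rank `0` (announced: BSTW Thm. 1.3, PRE).
[claim: BurungaleSkinnerTianWan2024, status: under-review] -/
def LowerDivisibility : Prop := D.L ∣ D.xi

/-- **(MC↑) the Kato-side divisibility** `ξ_p^ε ∣ L_p^ε` in `Λ` (Kobayashi 2003 Thm. 4.1 /
Thm. 1.3: integral when `ρ_{E,p}` is surjective). Recorded for symmetry; nothing asserted.
[cite: Kobayashi2003, Thm. 4.1 (shape only; nothing asserted)] -/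
def UpperDivisibility : Prop := D.xi ∣ D.L

end SignedDatum

section Chain

variable (W : WeierstrassCurve ℚ) [W.IsElliptic] [W.IsGloballyMinimal] (p : ℕ) [Fact p.Prime]

omit [W.IsGloballyMinimal] in
/-- Bookkeeping: in analytic rank `0`, `#Ш_an = t · #E(ℚ)_tors² / ∏c_ℓ` with `t = L(E,1)/Ω_E`
(GZK gives `rank E(ℚ) = 0`, so `Reg = 1`). [folklore] -/
theorem shaAn_eq_of_analyticRank_eq_zero (hGZK : rank_eq_analyticRank_of_analyticRank_le_one)
    (hr : W.analyticRank = 0) {t : ℚ}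
    (ht : W.entireLFunction 1 / (W.realPeriodRat : ℂ) = (t : ℂ)) :
    shaAn W = ((t * (W.torsionOrder : ℚ) ^ 2 / (W.tamagawaProduct : ℚ) : ℚ) : ℂ) := by
  have hr0 : W.mordellWeilRank = 0 := (hGZK W (by omega)).1.trans hr
  have hReg : W.regulator = 1 := W.regulator_eq_one_of_rank_zero hr0
  have hΩC : (W.realPeriodRat : ℂ) ≠ 0 := Complex.ofReal_ne_zero.mpr W.realPeriodRat_pos_holds.ne'
  have hc : 0 < W.tamagawaProduct := W.tamagawaProduct_pos'
  have hL1 : W.entireLFunction 1 = (t : ℂ) * (W.realPeriodRat : ℂ) := by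
    rw [← ht, div_mul_cancel₀ _ hΩC]
  rw [shaAn_def, W.leadingLCoeff_eq_of_analyticRank_eq_zero hr, hL1, hReg]
  have hcC : ((W.tamagawaProduct : ℚ) : ℂ) ≠ 0 := by exact_mod_cast hc.ne'
  push_cast
  field_simp

omit [W.IsGloballyMinimal] in
/-- Bookkeeping: the `p`-adic valuation of `#Ш_an = t·#tors²/∏c` in rank `0` when `p ∤ #E(ℚ)_tors`
(irreducible `E[p]`): `ord_p #Ш_an = ord_p t − ord_p ∏c_ℓ`. [folklore] -/
theorem padicValRat_shaAn_witness (hirr : W.HasIrreducibleModPGaloisRep p) {t : ℚ} (ht0 : t ≠ 0) :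
    padicValRat p (t * (W.torsionOrder : ℚ) ^ 2 / (W.tamagawaProduct : ℚ)) =
      padicValRat p t - padicValNat p W.tamagawaProduct := by
  have hT0 : (W.torsionOrder : ℚ) ≠ 0 := by exact_mod_cast W.torsionOrder_pos_holds.ne'
  have hcq0 : (W.tamagawaProduct : ℚ) ≠ 0 := by exact_mod_cast W.tamagawaProduct_pos'.ne'
  rw [padicValRat.div (mul_ne_zero ht0 (pow_ne_zero 2 hT0)) hcq0,
    padicValRat.mul ht0 (pow_ne_zero 2 hT0), padicValRat.pow, padicValRat.of_nat, padicValRat.of_nat,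
    padicValNat_torsionOrder_eq_zero_of_irreducible W p hirr]
  simp only [Nat.cast_zero, mul_zero, add_zero]

omit [W.IsGloballyMinimal] in
/-- **(K) read in valuations.** In analytic rank `0` (GZK: `E(ℚ)` finite, `Ш` finite, so
`#Sel_{p^∞}(E/ℚ) = #Ш[p^∞]` by the tree theorem `natCard_selmerGroupPInfty_eq_natCard_primaryComponent_sha`),
Kim's identity gives `ξ^ε(0) ≠ 0` and `ord_p ξ^ε(0) = ord_p ∏c_ℓ + ord_p #Ш`.
[cite: RaySprung2025, §1.2 (p. 2343)] [cite: GreenbergLNM1716, §4 p. 103] -/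
theorem valuation_constantCoeff_xi (hGZK : rank_eq_analyticRank_of_analyticRank_le_one)
    (hL : W.entireLFunction 1 ≠ 0) (D : SignedDatum W p) (hK : D.EulerCharacteristic) :
    ((PowerSeries.constantCoeff D.xi : ℤ_[p]) : ℚ_[p]) ≠ 0 ∧
      (((PowerSeries.constantCoeff D.xi : ℤ_[p]) : ℚ_[p])).valuation =
        (padicValNat p W.tamagawaProduct : ℤ) + padicValNat p W.shaOrder := by
  have hpP : p.Prime := Fact.out
  have hr : W.analyticRank = 0 := analyticRank_eq_zero_of_entireLFunction_one_ne_zero W hL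
  have hr0 : W.mordellWeilRank = 0 := (hGZK W (by omega)).1.trans hr
  haveI hfinE : Finite W.toAffine.Point := W.mordellWeilRank_eq_zero_iff_finite.mp hr0
  haveI hfinSha : Finite W.sha := (hGZK W (by omega)).2
  have hSel : Nat.card (W.selmerGroupPInfty p) =
      Nat.card (AddCommGroup.primaryComponent W.sha p) :=
    W.natCard_selmerGroupPInfty_eq_natCard_primaryComponent_sha p
  have hcardpos : 0 < Nat.card (AddCommGroup.primaryComponent W.sha p) := Nat.card_pos
  have hSelfin : Finite (W.selmerGroupPInfty p) :=
    Nat.finite_of_card_ne_zero (by rw [hSel]; exact hcardpos.ne')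
  obtain ⟨u, hu⟩ := hK hSelfin
  have hpow : ((p : ℚ_[p]) ^ (padicValNat p W.tamagawaProduct)) =
      ((p ^ (padicValNat p W.tamagawaProduct) : ℕ) : ℚ_[p]) := by norm_cast
  rw [hpow, hSel] at hu
  have hS0 : ((Nat.card (AddCommGroup.primaryComponent W.sha p) : ℕ) : ℚ_[p]) ≠ 0 := by
    exact_mod_cast hcardpos.ne'
  have hP0 : ((p ^ (padicValNat p W.tamagawaProduct) : ℕ) : ℚ_[p]) ≠ 0 := by
    exact_mod_cast pow_ne_zero _ hpP.ne_zero
  have hne : ((PowerSeries.constantCoeff D.xi : ℤ_[p]) : ℚ_[p]) ≠ 0 := by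
    rw [hu]; exact mul_ne_zero (mul_ne_zero (coe_units_ne_zero p u) hP0) hS0
  refine ⟨hne, ?_⟩
  have h := congrArg Padic.valuation hu
  rw [Padic.valuation_mul (mul_ne_zero (coe_units_ne_zero p u) hP0) hS0,
    Padic.valuation_mul (coe_units_ne_zero p u) hP0, valuation_coe_units_eq_zero,
    Padic.valuation_natCast, Padic.valuation_natCast, padicValNat.prime_pow,
    padicValNat_card_addPrimaryComponent (A := W.sha) p] at h
  rw [h, WeierstrassCurve.shaOrder]
  ring

omit [W.IsElliptic] [W.IsGloballyMinimal] in
/-- **(P) read in valuations**: `L^ε(0) = c·t` with `p ∤ c` and `L^ε(0) ≠ 0` give `t ≠ 0` and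
`ord_p L^ε(0) = ord_p t`. [cite: Kobayashi2003, §3 (shape only; nothing asserted)] -/
theorem valuation_constantCoeff_L (D : SignedDatum W p) (hc : ¬ p ∣ D.c) {t : ℚ}
    (hLt : ((PowerSeries.constantCoeff D.L : ℤ_[p]) : ℚ_[p]) = (D.c : ℚ_[p]) * ((t : ℚ) : ℚ_[p]))
    (hL0ne : ((PowerSeries.constantCoeff D.L : ℤ_[p]) : ℚ_[p]) ≠ 0) :
    t ≠ 0 ∧ (((PowerSeries.constantCoeff D.L : ℤ_[p]) : ℚ_[p])).valuation = padicValRat p t := by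
  have ht0 : ((t : ℚ) : ℚ_[p]) ≠ 0 := by
    intro h0
    exact hL0ne (by rw [hLt, h0, mul_zero])
  have hc0 : (D.c : ℚ_[p]) ≠ 0 := by
    intro h0
    exact hL0ne (by rw [hLt, h0, zero_mul])
  refine ⟨by rintro rfl; exact ht0 (by simp), ?_⟩
  rw [hLt, Padic.valuation_mul hc0 ht0, Padic.valuation_natCast, Padic.valuation_ratCast,
    padicValNat.eq_zero_of_not_dvd hc]
  simp

omit [W.IsGloballyMinimal] in
/-- **The ± rank-zero chain (lower half).** At a prime `p` with `E[p]` irreducible, in analytic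
rank `0` (`L(E,1) ≠ 0`): a signed datum satisfying Kim's Euler characteristic (K), Pollack's
interpolation (P) with `p ∤ c`, and the Eisenstein divisibility (MC↓) `L^ε ∣ ξ^ε` forces
`ord_p #Ш_an ≤ ord_p #Ш` (`MissingLowerBoundAt W p`). Proof: `ξ^ε = L^ε · h` in `Λ` gives
`ord_p ξ^ε(0) ≥ ord_p L^ε(0) = ord_p(L(E,1)/Ω_E)`, while (K) with GZK (`E(ℚ)` finite, `Ш` finite,
`#Sel_{p^∞} = #Ш[p^∞]`) gives `ord_p ξ^ε(0) = ord_p ∏c_ℓ + ord_p #Ш`; `p ∤ #E(ℚ)_tors` by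
irreducibility. Nothing beyond the displayed binders is used.
[cite: RaySprung2025, §1.2 (p. 2343)] [cite: Kobayashi2003, §3 and Thm. 1.2] [cite: Miller2011LMS, Def. 1.1] -/
theorem missingLowerBoundAt_of_signedLowerDivisibility
    (hGZK : rank_eq_analyticRank_of_analyticRank_le_one)
    (hirr : W.HasIrreducibleModPGaloisRep p) (hL : W.entireLFunction 1 ≠ 0)
    (D : SignedDatum W p) (hc : ¬ p ∣ D.c) (hK : D.EulerCharacteristic) (hP : D.Interpolation)
    (hdiv : D.LowerDivisibility) : MissingLowerBoundAt W p := by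
  have hr : W.analyticRank = 0 := analyticRank_eq_zero_of_entireLFunction_one_ne_zero W hL
  obtain ⟨hξne, hvξ⟩ := valuation_constantCoeff_xi W p hGZK hL D hK
  -- (MC↓): `ξ = L · h`, so `ord_p L(0) ≤ ord_p ξ(0)`
  obtain ⟨h, hh⟩ := hdiv
  have hfac : ((PowerSeries.constantCoeff D.xi : ℤ_[p]) : ℚ_[p]) =
      ((PowerSeries.constantCoeff D.L : ℤ_[p]) : ℚ_[p]) *
        ((PowerSeries.constantCoeff h : ℤ_[p]) : ℚ_[p]) := by
    rw [hh, map_mul]; push_cast; rfl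
  have hL0ne : ((PowerSeries.constantCoeff D.L : ℤ_[p]) : ℚ_[p]) ≠ 0 :=
    fun h0 => hξne (by rw [hfac, h0, zero_mul])
  have hh0ne : ((PowerSeries.constantCoeff h : ℤ_[p]) : ℚ_[p]) ≠ 0 :=
    fun h0 => hξne (by rw [hfac, h0, mul_zero])
  have hle : (((PowerSeries.constantCoeff D.L : ℤ_[p]) : ℚ_[p])).valuation ≤
      (((PowerSeries.constantCoeff D.xi : ℤ_[p]) : ℚ_[p])).valuation := by
    rw [hfac, Padic.valuation_mul hL0ne hh0ne]
    have := valuation_coe_padicInt_nonneg _ hh0ne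
    linarith
  -- (P): `L(0) = c · t`, `p ∤ c`
  obtain ⟨t, ht, hLt⟩ := hP
  obtain ⟨ht0, hvL⟩ := valuation_constantCoeff_L W p D hc hLt hL0ne
  have hmain : padicValRat p t ≤ (padicValNat p W.tamagawaProduct : ℤ) + padicValNat p W.shaOrder := by
    rw [← hvL, ← hvξ]; exact hle
  refine ⟨t * (W.torsionOrder : ℚ) ^ 2 / (W.tamagawaProduct : ℚ),
    shaAn_eq_of_analyticRank_eq_zero W hGZK hr ht, ?_⟩
  rw [padicValRat_shaAn_witness W p hirr ht0]
  linarith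

omit [W.IsGloballyMinimal] in
/-- **The ± rank-zero chain (upper half), for symmetry.** Under the same bookkeeping, the Kato-side
divisibility (MC↑) `ξ^ε ∣ L^ε` gives `ord_p #Ш ≤ ord_p #Ш_an` (`MissingUpperBoundAt W p`). On X6
this half is already in print as Wuthrich 2014 Prop. 21 (`Typed.missingUpperBoundAt_of_wuthrich`);
recorded only to display that (MC↓) ∧ (MC↑) is exactly `MissingPPartAt`.
[cite: RaySprung2025, §1.2 (p. 2343)] [cite: Kobayashi2003, Thm. 4.1] [cite: Miller2011LMS, Def. 1.1] -/
theorem missingUpperBoundAt_of_signedUpperDivisibility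
    (hGZK : rank_eq_analyticRank_of_analyticRank_le_one)
    (hirr : W.HasIrreducibleModPGaloisRep p) (hL : W.entireLFunction 1 ≠ 0)
    (D : SignedDatum W p) (hc : ¬ p ∣ D.c) (hK : D.EulerCharacteristic) (hP : D.Interpolation)
    (hdiv : D.UpperDivisibility) : MissingUpperBoundAt W p := by
  have hr : W.analyticRank = 0 := analyticRank_eq_zero_of_entireLFunction_one_ne_zero W hL
  obtain ⟨hξne, hvξ⟩ := valuation_constantCoeff_xi W p hGZK hL D hK
  obtain ⟨t, ht, hLt⟩ := hP
  -- (MC↑): `L = ξ · h`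
  obtain ⟨h, hh⟩ := hdiv
  have hfac : ((PowerSeries.constantCoeff D.L : ℤ_[p]) : ℚ_[p]) =
      ((PowerSeries.constantCoeff D.xi : ℤ_[p]) : ℚ_[p]) *
        ((PowerSeries.constantCoeff h : ℤ_[p]) : ℚ_[p]) := by
    rw [hh, map_mul]; push_cast; rfl
  -- `L(0) ≠ 0`: otherwise `c·t = 0`, so `t = 0`, so `L(E,1) = 0`
  have hL0ne : ((PowerSeries.constantCoeff D.L : ℤ_[p]) : ℚ_[p]) ≠ 0 := by
    intro h0
    have hcne : D.c ≠ 0 := fun hc0 => hc (by rw [hc0]; exact dvd_zero p)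
    have hc0 : (D.c : ℚ_[p]) ≠ 0 := by exact_mod_cast hcne
    have htz : ((t : ℚ) : ℚ_[p]) = 0 := (mul_eq_zero.mp (hLt.symm.trans h0).symm.symm).resolve_left hc0
    have ht0 : t = 0 := by exact_mod_cast htz
    have hΩC : (W.realPeriodRat : ℂ) ≠ 0 := Complex.ofReal_ne_zero.mpr W.realPeriodRat_pos_holds.ne'
    apply hL
    have h1 := ht
    rw [ht0, div_eq_iff hΩC] at h1
    simpa using h1
  have hh0ne : ((PowerSeries.constantCoeff h : ℤ_[p]) : ℚ_[p]) ≠ 0 :=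
    fun h0 => hL0ne (by rw [hfac, h0, mul_zero])
  have hle : (((PowerSeries.constantCoeff D.xi : ℤ_[p]) : ℚ_[p])).valuation ≤
      (((PowerSeries.constantCoeff D.L : ℤ_[p]) : ℚ_[p])).valuation := by
    rw [hfac, Padic.valuation_mul hξne hh0ne]
    have := valuation_coe_padicInt_nonneg _ hh0ne
    linarith
  obtain ⟨ht0, hvL⟩ := valuation_constantCoeff_L W p D hc hLt hL0ne
  have hmain : (padicValNat p W.tamagawaProduct : ℤ) + padicValNat p W.shaOrder ≤ padicValRat p t := by
    rw [← hvL, ← hvξ]; exact hle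
  refine ⟨t * (W.torsionOrder : ℚ) ^ 2 / (W.tamagawaProduct : ℚ),
    shaAn_eq_of_analyticRank_eq_zero W hGZK hr ht, ?_⟩
  rw [padicValRat_shaAn_witness W p hirr ht0]
  linarith

/-- **X6 ∩ {r_an = 0}, odd `p`: `BSD(E,p)` from ONE signed divisibility.** On class X6
(`ClassX6 W p`: good supersingular, semistable, `p ≥ 5 ∨ a_3 = 0`) at an odd prime in analytic
rank `0`, granted Wuthrich 2014 Prop. 21 (`hW`, PUB; its image proviso automatic by `ClassX6.surj`),
GZK (`hGZK`) and modularity (`hmod`): a signed datum with (K), (P), `p ∤ c` and the Eisenstein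
divisibility (MC↓) gives Miller's `BSDp W p` — irreducibility of `E[p]` is automatic
(`ClassX6.irr`, Serre 1972 Prop. 12). The OPEN input is (MC↓) alone (announced: BSTW Thm. 1.3).
[cite: Wuthrich2014, Prop. 21 (p. 400)] [cite: RaySprung2025, §1.2 (p. 2343)]
[cite: Serre1972, §1.11 Prop. 12] [claim: BurungaleSkinnerTianWan2024, status: under-review] -/
theorem X6.bsdp_of_signedLowerDivisibility_of_analyticRank_eq_zero
    (hW : Wuthrich2014.sha_dvd_analyticSha)
    (hGZK : rank_eq_analyticRank_of_analyticRank_le_one) (hmod : hasEntireLFunction_rat)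
    (hp : p ≠ 2) (hX : ClassX6 W p) (h0 : W.analyticRank = 0)
    (D : SignedDatum W p) (hc : ¬ p ∣ D.c) (hK : D.EulerCharacteristic) (hP : D.Interpolation)
    (hdiv : D.LowerDivisibility) : BSDp W p := by
  have hL : W.entireLFunction 1 ≠ 0 := (W.analyticRank_eq_zero_iff_holds (hmod W)).1 h0
  exact X6.bsdp_of_missingLowerBoundAt_of_analyticRank_eq_zero W p hW hGZK hmod hp hX h0
    (missingLowerBoundAt_of_signedLowerDivisibility W p hGZK (ClassX6.irr W p hp hX) hL D hc hK hP
      hdiv)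

end Chain

end Summit.BirchSwinnertonDyer.Rank1Residual.Supersingular

end
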